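import Summits.ResolutionOfSingularities.ResolutionOfSingularities.Theorems.WildPurityWildSymbolNoLU
import Literature.AlgebraicGeometry.Resolution.AffineDomainDimension
import Literature.Barriers.ResolutionOfSingularities.DimensionFourFrontier
import HarnessLib

/-!
# `WildSymbol` (stmt-ResolutionOfSingularities-17133), line `birth` — the DIMENSION-FOUR calibration,
# kernel-checked: a witness has `trdeg_k K ≥ 4` and refutes `LU_d` for `d = dim R ≥ 4`
# (modulo Gros–Suwa 1988 and Cossart–Piltant 2019)

Support file for crux #2 of route `ResolutionOfSingularities/WildPurity`
(`Summit.ResolutionOfSingularities.ResolutionOfSingularities.Theses.WildPurity.WildSymbol`), line `birth`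
(lead c3, crux cycle 4). Companion of `Theorems/WildPurityWildSymbolNoLU.lean` (a witness sits at a valuation ring
without relative local uniformization, modulo `GrosSuwa1988_purity`). Here the same mechanism is run against the
tree's DIMENSION-BOUNDED local uniformization predicates: `LocalUniformizationUpToDim k d` of the barrier file
`Literature/Barriers/ResolutionOfSingularities/DimensionFourFrontier.lean` (relative LU of affine models of
dimension `≤ d`) and the named fact `CossartPiltant2019LU3` (`LU₃` over every field, Cossart–Piltant 2019).

## What is proved

* `mem_Unr_of_divIntegral_of_luUpToDim`, `not_luUpToDim_of_witness` — modulo Gros–Suwa, `LU_d` over `k` kills every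
  candidate class above every model `R` of Krull dimension `≤ d`; a witness on such a model refutes `LU_d`.
* `three_lt_trdeg_of_witness`, `three_lt_ringKrullDim_of_witness` — **the route's calibration "trdeg `K ≥ 4`",
  kernel-checked** modulo `GrosSuwa1988_purity` and `CossartPiltant2019LU3`: the function field of a witness has
  transcendence degree `> 3` over `k`, and its affine model `R` has Krull dimension `> 3`.
* `not_wildSymbol_trdeg_le_three` — CALIBRATION (negative lemma): the crux with the extra conjunct
  `Algebra.trdeg k K ≤ 3` is false (modulo the two facts); `wildSymbol_iff_three_lt_trdeg` — equivalently the crux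
  may be read with the conjunct `¬ Algebra.trdeg k K ≤ 3` added for free.
* `exists_not_luUpToDim_of_wildSymbol` — a witness yields a perfect field `k` of characteristic `p` and a `d ≥ 4`
  with `¬ LocalUniformizationUpToDim k d`: the crux refutes local uniformization in the witness's own dimension,
  which the DimensionFourFrontier places at `≥ 4` — "consumed, not evaded", now by a theorem rather than a remark.

All statements are conditional on the named facts they list and on nothing else; no definition is declared; nothing
here concludes the crux positively.
-/

noncomputable section

-- single-problem summit: the doubled namespace component `ResolutionOfSingularities` is forced
set_option linter.dupNamespace false

namespace Summit.ResolutionOfSingularities.ResolutionOfSingularities.Theorems.WildSymbol.Birth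

open Summit.ResolutionOfSingularities.ResolutionOfSingularities.Theses.WildPurity (WildSymbol)
open Literature.AlgebraicGeometry.Resolution
open Literature.Barriers.ResolutionOfSingularities
open Literature.NumberTheory.GaloisCohomology

variable {k K : Type} [Field k] [Field K] [Algebra k K]

/-- **`LU_d` kills every candidate class above a model of dimension `≤ d` (modulo Gros–Suwa 1988).** If
`LocalUniformizationUpToDim k d` holds, then for every finitely generated `R ⊆ O` with `Frac R = K` and
`dim R ≤ d` and every `α` with (D) for `R`, `α ∈ Unr(O)`: refine `R` to a regular-at-the-centre `A ⊆ O`, weaken (D)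
to `A` (`divIntegral_antitone`), and apply the regular-point theorem. [cite: GrosSuwa1988, Thm. 1.4] -/
theorem mem_Unr_of_divIntegral_of_luUpToDim (hGS : GrosSuwa1988_purity.{0}) {d : ℕ}
    (hLU : LocalUniformizationUpToDim.{0} k d) {p : ℕ} (hp : p.Prime) [CharP k p] [PerfectField k]
    (O : ValuationSubring K) (R : Subalgebra k K) (hRfg : R.FG) (hRO : R.toSubring ≤ O.toSubring)
    (hRfr : IsFractionRing R K) (hdim : ringKrullDim R ≤ d)
    (α : G K ⧸ N p K) (hdiv : DivIntegral p k K R O α) : α ∈ Unr p K O.toSubring := by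
  obtain ⟨A, hAO, hRA, hAfg, hreg⟩ := hLU K O R hRO hRfg hRfr hdim
  haveI hAfr : IsFractionRing A K := isFractionRing_of_le hRA hRfr
  exact mem_Unr_of_divIntegral_of_isRegularLocalRing hGS hp O A hAfg hAO hAfr
    (isRegularLocalRing_locAt_of_atPrime A O hAO hreg) α (divIntegral_antitone p hRA O hdiv)

/-- **A witness on a model of dimension `≤ d` refutes `LU_d` over `k`** (modulo Gros–Suwa 1988).
[cite: GrosSuwa1988, Thm. 1.4] -/
theorem not_luUpToDim_of_witness (hGS : GrosSuwa1988_purity.{0}) {d : ℕ} {p : ℕ} (hp : p.Prime)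
    [CharP k p] [PerfectField k] (O : ValuationSubring K) (R : Subalgebra k K) (hRfg : R.FG)
    (hRO : R.toSubring ≤ O.toSubring) (hRfr : IsFractionRing R K) (hdim : ringKrullDim R ≤ d)
    (α : G K ⧸ N p K) (hdiv : DivIntegral p k K R O α) (hα : α ∉ Unr p K O.toSubring) :
    ¬ LocalUniformizationUpToDim.{0} k d :=
  fun hLU => hα (mem_Unr_of_divIntegral_of_luUpToDim hGS hLU hp O R hRfg hRO hRfr hdim α hdiv)

/-- **Calibration "trdeg `K ≥ 4`", kernel-checked** (modulo Gros–Suwa 1988 and Cossart–Piltant 2019): the function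
field of a witness `(R, O, α)` has transcendence degree `> 3` over `k` — in transcendence degree `≤ 3` every
valuation ring has relative local uniformization (`CossartPiltant2019LU3.relLocalUniformization`), which kills the
candidate (`not_relLU_of_witness`). [cite: CossartPiltant2019, Thm. 1.1 with §4.1 (LU)] -/
theorem three_lt_trdeg_of_witness (hGS : GrosSuwa1988_purity.{0}) (hCP : CossartPiltant2019LU3.{0})
    {p : ℕ} (hp : p.Prime) [CharP k p] [PerfectField k] (O : ValuationSubring K) (R : Subalgebra k K)
    (hRfg : R.FG) (hRO : R.toSubring ≤ O.toSubring) (hRfr : IsFractionRing R K)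
    (α : G K ⧸ N p K) (hdiv : DivIntegral p k K R O α) (hα : α ∉ Unr p K O.toSubring) :
    ¬ Algebra.trdeg k K ≤ 3 :=
  fun h3 => not_relLU_of_witness hGS hp O R hRfg hRO hRfr α hdiv hα
    (hCP.relLocalUniformization k K h3 O)

/-- **… and the affine model of a witness has Krull dimension `> 3`** (modulo the same two facts):
`LU₃ = LocalUniformizationUpToDim k 3` is `CossartPiltant2019LU3` at `k`. [cite: CossartPiltant2019, Thm. 1.1 with §4.1 (LU)] -/
theorem three_lt_ringKrullDim_of_witness (hGS : GrosSuwa1988_purity.{0}) (hCP : CossartPiltant2019LU3.{0})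
    {p : ℕ} (hp : p.Prime) [CharP k p] [PerfectField k] (O : ValuationSubring K) (R : Subalgebra k K)
    (hRfg : R.FG) (hRO : R.toSubring ≤ O.toSubring) (hRfr : IsFractionRing R K)
    (α : G K ⧸ N p K) (hdiv : DivIntegral p k K R O α) (hα : α ∉ Unr p K O.toSubring) :
    ¬ ringKrullDim R ≤ 3 :=
  fun h3 => not_luUpToDim_of_witness hGS hp O R hRfg hRO hRfr h3 α hdiv hα
    ((localUniformizationUpToDim_three_iff k).mpr (hCP k))

/-- **CALIBRATION (negative lemma): no witness in transcendence degree `≤ 3`** (modulo Gros–Suwa 1988 and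
Cossart–Piltant 2019): the crux with the extra conjunct `Algebra.trdeg k K ≤ 3` is false.
[cite: CossartPiltant2019, Thm. 1.1 with §4.1 (LU)] -/
theorem not_wildSymbol_trdeg_le_three (hGS : GrosSuwa1988_purity.{0}) (hCP : CossartPiltant2019LU3.{0}) :
    ¬ ∃ p : ℕ, p.Prime ∧ ∃ (k K : Type) (_ : Field k) (_ : CharP k p) (_ : PerfectField k) (_ : Field K)
      (_ : Algebra k K), (⊤ : IntermediateField k K).FG ∧ Algebra.trdeg k K ≤ 3 ∧ ∃ O : ValuationSubring K,
      (∀ c : k, algebraMap k K c ∈ O) ∧ ∃ R : Subalgebra k K, R.FG ∧ R.toSubring ≤ O.toSubring ∧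
      IsFractionRing R K ∧ ∃ α : G K ⧸ N p K, DivIntegral p k K R O α ∧ α ∉ Unr p K O.toSubring := by
  rintro ⟨p, hp, k, K, _, _, _, _, _, -, h3, O, -, R, hR, hRO, hfr, α, hdiv, hα⟩
  exact three_lt_trdeg_of_witness hGS hCP hp O R hR hRO hfr α hdiv hα h3

/-- **The crux carries the conjunct "trdeg `> 3`" for free** (modulo Gros–Suwa 1988 and Cossart–Piltant 2019):
`WildSymbol` is equivalent to its restatement with `¬ Algebra.trdeg k K ≤ 3` added. [cite: CossartPiltant2019, Thm. 1.1 with §4.1 (LU)] -/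
theorem wildSymbol_iff_three_lt_trdeg (hGS : GrosSuwa1988_purity.{0}) (hCP : CossartPiltant2019LU3.{0}) :
    WildSymbol ↔ ∃ p : ℕ, p.Prime ∧ ∃ (k K : Type) (_ : Field k) (_ : CharP k p) (_ : PerfectField k)
      (_ : Field K) (_ : Algebra k K), (⊤ : IntermediateField k K).FG ∧ ¬ Algebra.trdeg k K ≤ 3 ∧
      ∃ O : ValuationSubring K, (∀ c : k, algebraMap k K c ∈ O) ∧ ∃ R : Subalgebra k K, R.FG ∧
      R.toSubring ≤ O.toSubring ∧ IsFractionRing R K ∧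
      ∃ α : G K ⧸ N p K, DivIntegral p k K R O α ∧ α ∉ Unr p K O.toSubring := by
  rw [wildSymbol_iff]
  constructor
  · rintro ⟨p, hp, k, K, ik, icp, ipf, iK, ialg, hfg, O, hO, R, hR, hRO, hfr, α, hdiv, hα⟩
    exact ⟨p, hp, k, K, ik, icp, ipf, iK, ialg, hfg,
      three_lt_trdeg_of_witness hGS hCP hp O R hR hRO hfr α hdiv hα, O, hO, R, hR, hRO, hfr, α, hdiv, hα⟩
  · rintro ⟨p, hp, k, K, ik, icp, ipf, iK, ialg, hfg, -, O, hO, R, hR, hRO, hfr, α, hdiv, hα⟩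
    exact ⟨p, hp, k, K, ik, icp, ipf, iK, ialg, hfg, O, hO, R, hR, hRO, hfr, α, hdiv, hα⟩

/-- **`WildSymbol` refutes local uniformization in the witness's own dimension, which is `≥ 4`** (modulo
Gros–Suwa 1988 and Cossart–Piltant 2019): a witness yields a perfect field `k` of characteristic `p` and a natural
number `d ≥ 4` (the Krull dimension of the witness's affine model, finite by the dimension theorem for affine
domains) with `¬ LocalUniformizationUpToDim k d`. [cite: CossartPiltant2019, Thm. 1.1 with §4.1 (LU)] -/
theorem exists_not_luUpToDim_of_wildSymbol (hGS : GrosSuwa1988_purity.{0})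
    (hCP : CossartPiltant2019LU3.{0}) (hW : WildSymbol) :
    ∃ p : ℕ, p.Prime ∧ ∃ (k : Type) (_ : Field k) (_ : CharP k p) (_ : PerfectField k) (d : ℕ),
      4 ≤ d ∧ ¬ LocalUniformizationUpToDim.{0} k d := by
  obtain ⟨p, hp, k, K, ik, icp, ipf, iK, ialg, -, O, -, R, hR, hRO, hfr, α, hdiv, hα⟩ :=
    wildSymbol_iff.mp hW
  haveI : Algebra.FiniteType k R := R.fg_iff_finiteType.mp hR
  obtain ⟨d, hd, -⟩ := Literature.AlgebraicGeometry.Resolution.exists_ringKrullDim_eq_and_trdeg_eq k R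
  refine ⟨p, hp, k, ik, icp, ipf, d, ?_, ?_⟩
  · by_contra hlt
    refine three_lt_ringKrullDim_of_witness hGS hCP hp O R hR hRO hfr α hdiv hα ?_
    rw [hd]
    exact_mod_cast Nat.lt_succ_iff.mp (not_le.mp hlt)
  · exact not_luUpToDim_of_witness hGS hp O R hR hRO hfr (le_of_eq hd) α hdiv hα

end Summit.ResolutionOfSingularities.ResolutionOfSingularities.Theorems.WildSymbol.Birth

end
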